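import Summits.RiemannHypothesis.RiemannHypothesis.Theorems.PfPersistenceDefectiveTransport
import HarnessLib

/-!
# Defective Grönwall transport — the rate-free member and the upper calibration `RH ⟹ defective law`
# (pub-rhpf, transport-1 gen 4, leaf G1.22 'TRANSPORT', track T-D, part 2; RH-free glue; def-free)

**mechanism/rigidity campaign; no RH claims.**  Companion text:
`run/shared/lean/pub/pub-rhpf/pub-rhpf-transport-1/TRANSPORT.md` §13.  Continues
`PfPersistenceDefectiveTransport` (defective leakage from one seed ⟹ floor ⟹ strip of width `δ`):

* `strip_of_speedLimitFrom` — the rate-free member `K ≡ 0`: an exponential SPEED LIMIT on the descent of the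
  bottom, `ε(x) − ε(x + h) ≤ h (C e^{δ x} + η)` for arbitrarily small `h > 0` past the seed, already confines every
  non-trivial zero to `|Re ρ − 1/2| ≤ δ`;
* `defectiveLeakageFrom_of_riemannHypothesis` — UPPER CALIBRATION: RH implies the defective clause for every `δ`
  and every `C ≥ 0` (tree: `DiniLeakage ↔ RH` given the PROVED `WindowLipschitz`, item 1039; Yoshida for
  `ε ≥ 0`; a non-negative defect only weakens the clause);
* `riemannHypothesis_of_subexpSpeedLimitFrom` / `riemannHypothesis_of_uniformSpeedLimitFrom` — a speed limit
  at EVERY rate `δ > 0`, in particular ONE uniform one-sided Lipschitz constant past the seed, is RH: the growth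
  exponent of the one-sided Lipschitz constant of `a ↦ ε(a)` (PROVED finite on compact ranges, item 1039) is the
  thermometer of this track.

So for each fixed `δ > 0` the defective class sits BETWEEN RH and the zero-free strip of width `δ`:
`RH ⟹ (defective leakage at rate δ from one seed) ⟹ |Re ρ − 1/2| ≤ δ`, both implications PROVED, neither
converse claimed (whether the class at `δ < 1/2` is strictly weaker than RH is the open question whether a zero-free
strip implies RH).  CONDITIONAL statements; no RH claim in either direction.
-/

noncomputable section

set_option linter.dupNamespace false  -- D-0017 nested layout: `RiemannHypothesis.RiemannHypothesis`

namespace Summit.RiemannHypothesis.RiemannHypothesis.Theorems.PfPersistenceDefectiveTransport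

open Set Filter Topology
open _root_.Literature.NumberTheory.LFunctions
open _root_.Summit.RiemannHypothesis.RiemannHypothesis.Theorems.WeilWindowFlowDiniLeakage
  (diniLeakage_iff_riemannHypothesis_of_windowLipschitz)
open _root_.Summit.RiemannHypothesis.RiemannHypothesis.Theorems.WeilWindowFlowWindowLipschitz
  (WindowLipschitz_proof)

/-! ## 1. The rate-free member: an exponential speed limit gives a strip -/

/-- **Speed limit ⟹ strip (`K ≡ 0` member of T-D).** If past a seed `0 < a₀ < (log 3)/2` the bottom never drops
faster than `C e^{δ x}` in the lower-right-Dini sense (`ε x − ε (x + h) ≤ h (C e^{δ x} + η)` for arbitrarily small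
`h > 0`; `C ≥ 0`, `δ > 0`), then every non-trivial zero has `|Re ρ − 1/2| ≤ δ`.  CONDITIONAL; RH-free; no RH
claim. [folklore] -/
theorem strip_of_speedLimitFrom {a₀ C δ : ℝ} (ha₀ : 0 < a₀) (ha₀' : a₀ < Real.log 3 / 2)
    (hC : 0 ≤ C) (hδ : 0 < δ)
    (h : ∀ x : ℝ, a₀ ≤ x → ∀ η δ' : ℝ, 0 < η → 0 < δ' →
      ∃ h : ℝ, 0 < h ∧ h < δ' ∧
        weilGroundEnergy x - weilGroundEnergy (x + h) ≤ h * (C * Real.exp (δ * x) + η))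
    {ρ : ℂ} (hρ : ρ ∈ ZetaZeros.riemannZetaNontrivialZeros) : |ρ.re - 1 / 2| ≤ δ :=
  strip_of_defectiveLeakageFrom ha₀ ha₀' hC hδ
    (fun A _ ↦ ⟨0, le_rfl, fun x hx η δ' hη hδ' ↦ by simpa using h x hx.1 η δ' hη hδ'⟩) hρ

/-! ## 2. Upper calibration: RH implies the defective law for every rate and defect -/

/-- **RH ⟹ the defective leakage clause, for every `δ` and every `C ≥ 0`.** Under RH the tree's `DiniLeakage`
holds (`diniLeakage_iff_riemannHypothesis_of_windowLipschitz` with the PROVED `WindowLipschitz_proof`), the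
bottoms are non-negative (Yoshida `riemannHypothesis_iff_forall_weilPositivityOn` + `weilGroundEnergy_nonneg_iff`),
and a non-negative defect only weakens the clause.  CONDITIONAL on RH as hypothesis; no RH claim. [folklore] -/
theorem defectiveLeakageFrom_of_riemannHypothesis (hRH : _root_.RiemannHypothesis) {a₀ : ℝ} (ha₀ : 0 < a₀)
    {C : ℝ} (hC : 0 ≤ C) (δ : ℝ) :
    ∀ A : ℝ, a₀ ≤ A → ∃ K : ℝ, 0 ≤ K ∧ ∀ x ∈ Ico a₀ A, ∀ η δ' : ℝ, 0 < η → 0 < δ' →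
      ∃ h : ℝ, 0 < h ∧ h < δ' ∧
        weilGroundEnergy x - weilGroundEnergy (x + h) ≤
          h * (K * weilGroundEnergy x + C * Real.exp (δ * x) + η) := by
  intro A hA
  have hD := (diniLeakage_iff_riemannHypothesis_of_windowLipschitz WindowLipschitz_proof).2 hRH
  obtain ⟨K, hK⟩ := hD a₀ A ha₀ hA
  refine ⟨max K 0, le_max_right _ _, fun x hx η δ' hη hδ' ↦ ?_⟩
  obtain ⟨h, hpos, hlt, hle⟩ := hK x hx.1 hx.2.le η δ' hη hδ'
  refine ⟨h, hpos, hlt, hle.trans ?_⟩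
  have hx0 : 0 < x := ha₀.trans_le hx.1
  have hεpos : 0 ≤ weilGroundEnergy x :=
    (weilGroundEnergy_nonneg_iff_holds hx0).2 (riemannHypothesis_iff_forall_weilPositivityOn.1 hRH x hx0)
  have h1 : K * weilGroundEnergy x ≤ max K 0 * weilGroundEnergy x :=
    mul_le_mul_of_nonneg_right (le_max_left _ _) hεpos
  have h2 : 0 ≤ C * Real.exp (δ * x) := by positivity
  have h3 : K * weilGroundEnergy x + η ≤ max K 0 * weilGroundEnergy x + C * Real.exp (δ * x) + η := by
    linarith
  exact mul_le_mul_of_nonneg_left h3 hpos.le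


/-- **Sub-exponential speed limit ⟹ RH.** If for EVERY `δ > 0` the descent of the bottom past the seed is
bounded by `C_δ e^{δ x}` (lower-right-Dini sense), then RH (`riemannHypothesis_of_defectiveLeakageFrom_all` with
`K ≡ 0`).  CONDITIONAL; no RH claim. [folklore] -/
theorem riemannHypothesis_of_subexpSpeedLimitFrom {a₀ : ℝ} (ha₀ : 0 < a₀) (ha₀' : a₀ < Real.log 3 / 2)
    (h : ∀ δ : ℝ, 0 < δ → ∃ C : ℝ, 0 ≤ C ∧ ∀ x : ℝ, a₀ ≤ x → ∀ η δ' : ℝ, 0 < η → 0 < δ' →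
      ∃ h : ℝ, 0 < h ∧ h < δ' ∧
        weilGroundEnergy x - weilGroundEnergy (x + h) ≤ h * (C * Real.exp (δ * x) + η)) :
    _root_.RiemannHypothesis :=
  riemannHypothesis_of_defectiveLeakageFrom_all ha₀ ha₀' fun δ hδ ↦ by
    obtain ⟨C, hC, hCx⟩ := h δ hδ
    exact ⟨C, hC, fun A _ ↦ ⟨0, le_rfl, fun x hx η δ' hη hδ' ↦ by simpa using hCx x hx.1 η δ' hη hδ'⟩⟩

/-- **A UNIFORM one-sided Lipschitz bound ⟹ RH.** The tree proves `WindowLipschitz` (item 1039): on every compact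
window range the bottom drops at a bounded speed `L(b₀, A)`.  If ONE constant served past the seed —
`ε x − ε (x + h) ≤ h (L + η)` for arbitrarily small `h > 0` at every `x ≥ a₀` — the floor `ε(a) ≥ −(L/δ) e^{δ a}`
would hold for every `δ > 0`, hence RH: the GROWTH of the one-sided Lipschitz constant of `a ↦ ε(a)` is the
thermometer of this track (growth exponent `δ` ⟹ strip of width `δ`, `strip_of_speedLimitFrom`).  CONDITIONAL;
no RH claim. [folklore] -/
theorem riemannHypothesis_of_uniformSpeedLimitFrom {a₀ L : ℝ} (ha₀ : 0 < a₀) (ha₀' : a₀ < Real.log 3 / 2)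
    (hL : 0 ≤ L)
    (h : ∀ x : ℝ, a₀ ≤ x → ∀ η δ' : ℝ, 0 < η → 0 < δ' →
      ∃ h : ℝ, 0 < h ∧ h < δ' ∧ weilGroundEnergy x - weilGroundEnergy (x + h) ≤ h * (L + η)) :
    _root_.RiemannHypothesis := by
  refine riemannHypothesis_of_subexpSpeedLimitFrom ha₀ ha₀' fun δ hδ ↦ ⟨L, hL, fun x hx η δ' hη hδ' ↦ ?_⟩
  obtain ⟨h, hpos, hlt, hle⟩ := h x hx η δ' hη hδ'
  refine ⟨h, hpos, hlt, hle.trans (mul_le_mul_of_nonneg_left ?_ hpos.le)⟩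
  have h1 : 1 ≤ Real.exp (δ * x) := Real.one_le_exp (by nlinarith [ha₀.trans_le hx])
  nlinarith

/-- **The sandwich, stated once** (both directions PROVED; the class is the hypothesis in the middle): for
`0 < a₀ < (log 3)/2`, `C ≥ 0`, `δ > 0`,
RH ⟹ (defective leakage at rate `δ`, defect `C`, from `a₀`) ⟹ every non-trivial zero has `|Re ρ − 1/2| ≤ δ`.
No converse claimed; no RH claim. [folklore] -/
theorem defectiveLeakage_sandwich {a₀ C δ : ℝ} (ha₀ : 0 < a₀) (ha₀' : a₀ < Real.log 3 / 2)
    (hC : 0 ≤ C) (hδ : 0 < δ) :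
    (_root_.RiemannHypothesis →
      ∀ A : ℝ, a₀ ≤ A → ∃ K : ℝ, 0 ≤ K ∧ ∀ x ∈ Ico a₀ A, ∀ η δ' : ℝ, 0 < η → 0 < δ' →
        ∃ h : ℝ, 0 < h ∧ h < δ' ∧
          weilGroundEnergy x - weilGroundEnergy (x + h) ≤
            h * (K * weilGroundEnergy x + C * Real.exp (δ * x) + η)) ∧
    ((∀ A : ℝ, a₀ ≤ A → ∃ K : ℝ, 0 ≤ K ∧ ∀ x ∈ Ico a₀ A, ∀ η δ' : ℝ, 0 < η → 0 < δ' →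
        ∃ h : ℝ, 0 < h ∧ h < δ' ∧
          weilGroundEnergy x - weilGroundEnergy (x + h) ≤
            h * (K * weilGroundEnergy x + C * Real.exp (δ * x) + η)) →
      ∀ ρ : ℂ, ρ ∈ ZetaZeros.riemannZetaNontrivialZeros → |ρ.re - 1 / 2| ≤ δ) :=
  ⟨fun hRH ↦ defectiveLeakageFrom_of_riemannHypothesis hRH ha₀ hC δ,
    fun h _ hρ ↦ strip_of_defectiveLeakageFrom ha₀ ha₀' hC hδ h hρ⟩

end Summit.RiemannHypothesis.RiemannHypothesis.Theorems.PfPersistenceDefectiveTransport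

end
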